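import Summits.BirchSwinnertonDyer.BirchSwinnertonDyer.Theorems.SignedLowerHalvesSmallImageLowerHalfBothSignsRttD2J2DeltaAssembly
import Summits.BirchSwinnertonDyer.BirchSwinnertonDyer.Theorems.SignedLowerHalvesSmallImageLowerHalfBothSignsRttD2TwistTower
import Mathlib.Order.KonigLemma
import HarnessLib

/-!
# Route `SignedLowerHalves`, crux L `SmallImageLowerHalfBothSigns` (stmt-BirchSwinnertonDyer-23599), line `rtt_w3` v15 — E2, junction row J2,
# research half «δ₁», brick (δ-f): EXACTNESS `ker δ₁ = range sp¹` ON THE PINNED DATA (`hex₁` of the J2 socket)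

INPUTS hand `bsd-inputs-honda-p1` g24 under LEAD `cruxlead-stmt-BirchSwinnertonDyer-23599` g11 (v15.1, stub B `stub_charRoadJunction_ns`, row J2; J2 socket p786107). For pinned data
`D₁ D₂ : IwasawaCohomologyDataO S κ₁ κ₂ γ₁ γ₂ θ 𝔣 1/2`, `I : CycIwasawaCohomologyDataO S κ₁ γ₁ θ (suppPF p 𝔣) 1` and honda g23's specialisation `res : D₁.H →+ I.H`
(`I.proj n k (res y) = spLevel n k 1 (D₁.proj n k y)`, `…RttD2J2Corestriction.exists_coresHom`):
* §1 `layerRedLEO` (iterated reductions, the `k`-twin of g23's `layerCoresLEO`) and its laws; §2 ★ `exists_proj_mem_of_closed` — KŐNIG on the finite layer groups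
  `H¹(G_S(K̃_n), X_k)`: transition-closed level sets `A n k` with non-empty diagonal come from ONE element of `D₁.H` ((P4); box families as in -w3's `…RttD2SeqJ3Konig`);
* §3 ★★★ `deltaHom_res` (`δ ∘ sp = 0`, (L1)) and `exists_res_eq_of_deltaHom_eq_zero` (`δ x = 0 ⇒ x = sp y`: (L8) at every level, then §2), `deltaHom_eq_zero_iff`,
  and the socket form ★ `deltaTors_eq_zero_iff_mem_range` for any `s` with `s ∘ π = res` (`π` onto; honda's `s : 𝐇¹₂ ⧸ T₂ → 𝐇¹_cyc` with `s ∘ mk = res`).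
With brick (δ-e) this completes the J2 research half: `(deltaTors, deltaTors_smul, deltaTors_eq_zero_iff_mem_range)` are the binders `(δ₁, hδ₁, hex₁)` of
`SmallImageRttCharRoad.junction_coker_of_exact₂` at `b = 0`. THEOREMS + one def (`layerRedLEO`) (`--supports stmt-BirchSwinnertonDyer-23599` helper); no named fact,
no `sorry`; crux L, crux M, E2 and BSD remain OPEN and are proved for NO curve by any of this.
References: [PerrinRiou1994Invent] §1.3; [JohnsonLeungKings2011] §4.2 Lemma 4.4; [Rubin2000] Prop. B.1.1 (compactness / Kőnig); [NeukirchSchmidtWingberg2008] I §5 (1.5.1), (1.3.2);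
[SerreGaloisCohomology1997] III §4.1 Prop. 8 (finiteness of `H¹`).
-/

set_option autoImplicit false
-- the Theorems namespace of this sub repeats the summit name by design (D-0017 nested layout)
set_option linter.dupNamespace false

noncomputable section

open scoped NumberField
open Field IsDedekindDomain
open Literature.NumberTheory.GaloisRepresentations
open Literature.NumberTheory.EllipticCurves
open Literature.NumberTheory.ComplexMultiplication.EllipticUnits
open Literature.NumberTheory.ComplexMultiplication.EllipticUnits.JohnsonLeungKings2011
open Summit.BirchSwinnertonDyer.BirchSwinnertonDyer.Theorems.SmallImageRttD2J1
open Summit.BirchSwinnertonDyer.BirchSwinnertonDyer.Theorems.SmallImageRttD2J2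
open Summit.BirchSwinnertonDyer.BirchSwinnertonDyer.Theorems.SmallImageRttD2Twist

namespace Summit.BirchSwinnertonDyer.BirchSwinnertonDyer.Theorems.SmallImageRttD2J2Delta

variable {K : Type} [Field K] [NumberField K] {p : ℕ} [Fact p.Prime] (S : Set (PadicAlgCl p))
  (κ₁ κ₂ : ZpExtension K p) (θ : absoluteGaloisGroup K →ₜ* (padicCoeffIntegers S)ˣ) (𝔣 : Ideal (𝓞 K))

/-! ## §1 Iterated reductions on the pair layers -/

section RedLE

/-- **The iterated reduction `H^i(G_S(K̃_n), X_{K'}) → H^i(G_S(K̃_n), X_k)`** for `k ≤ K'` (composite of the one-step `layerRedO`). [cite: Kato2004Asterisque, §8.2 (p. 180)] -/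
def layerRedLEO (n i : ℕ) {k K' : ℕ} (h : k ≤ K') : layerCohO S κ₁ κ₂ θ 𝔣 n K' i →+ layerCohO S κ₁ κ₂ θ 𝔣 n k i :=
  Nat.leRec (motive := fun K' _ ↦ layerCohO S κ₁ κ₂ θ 𝔣 n K' i →+ layerCohO S κ₁ κ₂ θ 𝔣 n k i)
    (AddMonoidHom.id _) (fun K' _ f ↦ f.comp (layerRedO S κ₁ κ₂ θ 𝔣 n K' i)) h

omit [NumberField K] in
/-- `red_{k/k} = id`. [cite: Kato2004Asterisque, §8.2 (p. 180)] -/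
theorem layerRedLEO_refl (n i k : ℕ) (y : layerCohO S κ₁ κ₂ θ 𝔣 n k i) : layerRedLEO S κ₁ κ₂ θ 𝔣 n i (le_refl k) y = y := by
  rw [layerRedLEO, Nat.leRec_self]; rfl

omit [NumberField K] in
/-- Peeling at the top. [cite: Kato2004Asterisque, §8.2 (p. 180)] -/
theorem layerRedLEO_succ (n i : ℕ) {k K' : ℕ} (h : k ≤ K') (h' : k ≤ K' + 1) (y : layerCohO S κ₁ κ₂ θ 𝔣 n (K' + 1) i) :
    layerRedLEO S κ₁ κ₂ θ 𝔣 n i h' y = layerRedLEO S κ₁ κ₂ θ 𝔣 n i h (layerRedO S κ₁ κ₂ θ 𝔣 n K' i y) := by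
  rw [layerRedLEO, Nat.leRec_succ _ _ h]; rfl

omit [NumberField K] in
/-- Peeling at the bottom: `red_{k+1/k} ∘ red_{K'/k+1} = red_{K'/k}`. [cite: Kato2004Asterisque, §8.2 (p. 180)] -/
theorem layerRedO_layerRedLEO (n i k : ℕ) :
    ∀ (K' : ℕ) (h : k + 1 ≤ K') (h' : k ≤ K') (y : layerCohO S κ₁ κ₂ θ 𝔣 n K' i),
      layerRedO S κ₁ κ₂ θ 𝔣 n k i (layerRedLEO S κ₁ κ₂ θ 𝔣 n i h y) = layerRedLEO S κ₁ κ₂ θ 𝔣 n i h' y := by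
  refine Nat.le_induction (fun h' y ↦ ?_) (fun K' hK' ih h' y ↦ ?_)
  · rw [layerRedLEO_refl, layerRedLEO_succ S κ₁ κ₂ θ 𝔣 n i (le_refl k) h', layerRedLEO_refl]
  · rw [layerRedLEO_succ S κ₁ κ₂ θ 𝔣 n i hK' (Nat.le_succ_of_le hK'), ih (Nat.le_of_succ_le hK'), layerRedLEO_succ S κ₁ κ₂ θ 𝔣 n i (Nat.le_of_succ_le hK') h']

/-- The iterated reductions commute with the one-step corestriction. [cite: NeukirchSchmidtWingberg2008, I §5 Prop. 1.5.2] -/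
theorem layerCoresO_layerRedLEO (n i k : ℕ) :
    ∀ (K' : ℕ) (h : k ≤ K') (y : layerCohO S κ₁ κ₂ θ 𝔣 (n + 1) K' i),
      layerCoresO S κ₁ κ₂ θ 𝔣 n k i (layerRedLEO S κ₁ κ₂ θ 𝔣 (n + 1) i h y) = layerRedLEO S κ₁ κ₂ θ 𝔣 n i h (layerCoresO S κ₁ κ₂ θ 𝔣 n K' i y) := by
  refine Nat.le_induction (fun y ↦ ?_) (fun K' hK' ih y ↦ ?_)
  · rw [layerRedLEO_refl, layerRedLEO_refl]
  · rw [layerRedLEO_succ S κ₁ κ₂ θ 𝔣 (n + 1) i hK', ih, layerCoresO_layerRedO, layerRedLEO_succ S κ₁ κ₂ θ 𝔣 n i hK']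

end RedLE

/-! ## §2 Kőnig on the finite pair-layer groups -/

section Konig

variable {γ₁ γ₂ : absoluteGaloisGroup K} (D₁ : IwasawaCohomologyDataO S κ₁ κ₂ γ₁ γ₂ θ 𝔣 1) (A : ∀ n k : ℕ, Set (layerCohO S κ₁ κ₂ θ 𝔣 n k 1))

/-- Box families of level `m`: values in `A` on the box, one-step compatible inside the box, zero outside. [cite: NeukirchSchmidtWingberg2008, I §5 (1.5.1)] -/
def boxFamiliesO (m : ℕ) : Set (∀ n k : ℕ, layerCohO S κ₁ κ₂ θ 𝔣 n k 1) :=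
  {Y | (∀ n k, n ≤ m → k ≤ m → Y n k ∈ A n k) ∧ (∀ n k, n + 1 ≤ m → k ≤ m → layerCoresO S κ₁ κ₂ θ 𝔣 n k 1 (Y (n + 1) k) = Y n k) ∧
    (∀ n k, n ≤ m → k + 1 ≤ m → layerRedO S κ₁ κ₂ θ 𝔣 n k 1 (Y n (k + 1)) = Y n k) ∧ ∀ n k, ¬ (n ≤ m ∧ k ≤ m) → Y n k = 0}

/-- Truncation to a box (zero outside). [cite: NeukirchSchmidtWingberg2008, I §5 (1.5.1)] -/
def boxTruncO (m : ℕ) (Y : ∀ n k : ℕ, layerCohO S κ₁ κ₂ θ 𝔣 n k 1) : ∀ n k : ℕ, layerCohO S κ₁ κ₂ θ 𝔣 n k 1 :=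
  fun n k ↦ if n ≤ m ∧ k ≤ m then Y n k else 0

variable {S κ₁ κ₂ θ 𝔣 A}

omit [NumberField K] in
/-- Values of the truncation inside the box. [folklore] -/
theorem boxTruncO_of_le {m n k : ℕ} (Y : ∀ n k : ℕ, layerCohO S κ₁ κ₂ θ 𝔣 n k 1) (hn : n ≤ m) (hk : k ≤ m) : boxTruncO S κ₁ κ₂ θ 𝔣 m Y n k = Y n k :=
  if_pos ⟨hn, hk⟩

/-- Truncation of a box family is a box family. [cite: NeukirchSchmidtWingberg2008, I §5 (1.5.1)] -/
theorem boxTruncO_mem_boxFamiliesO {m m' : ℕ} (h : m ≤ m') {Y : ∀ n k : ℕ, layerCohO S κ₁ κ₂ θ 𝔣 n k 1} (hY : Y ∈ boxFamiliesO S κ₁ κ₂ θ 𝔣 A m') :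
    boxTruncO S κ₁ κ₂ θ 𝔣 m Y ∈ boxFamiliesO S κ₁ κ₂ θ 𝔣 A m := by
  refine ⟨fun n k hn hk ↦ ?_, fun n k hn hk ↦ ?_, fun n k hn hk ↦ ?_, fun n k hnk ↦ if_neg hnk⟩
  · rw [boxTruncO_of_le Y hn hk]; exact hY.1 n k (hn.trans h) (hk.trans h)
  · rw [boxTruncO_of_le Y hn hk, boxTruncO_of_le Y (Nat.le_of_succ_le hn) hk]; exact hY.2.1 n k (hn.trans h) (hk.trans h)
  · rw [boxTruncO_of_le Y hn hk, boxTruncO_of_le Y hn (Nat.le_of_succ_le hk)]; exact hY.2.2.1 n k (hn.trans h) (hk.trans h)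

omit [NumberField K] in
/-- Truncations compose. [folklore] -/
theorem boxTruncO_boxTruncO {m m' : ℕ} (h : m ≤ m') (Y : ∀ n k : ℕ, layerCohO S κ₁ κ₂ θ 𝔣 n k 1) :
    boxTruncO S κ₁ κ₂ θ 𝔣 m (boxTruncO S κ₁ κ₂ θ 𝔣 m' Y) = boxTruncO S κ₁ κ₂ θ 𝔣 m Y := funext fun n ↦ funext fun k ↦ by
  by_cases hnk : n ≤ m ∧ k ≤ m
  · rw [boxTruncO_of_le _ hnk.1 hnk.2, boxTruncO_of_le _ hnk.1 hnk.2, boxTruncO_of_le _ (hnk.1.trans h) (hnk.2.trans h)]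
  · unfold boxTruncO; rw [if_neg hnk, if_neg hnk]

/-- A box family of level `m` is its own truncation. [folklore] -/
theorem boxTruncO_eq_self {m : ℕ} {Y : ∀ n k : ℕ, layerCohO S κ₁ κ₂ θ 𝔣 n k 1} (hY : Y ∈ boxFamiliesO S κ₁ κ₂ θ 𝔣 A m) : boxTruncO S κ₁ κ₂ θ 𝔣 m Y = Y :=
  funext fun n ↦ funext fun k ↦ by
    by_cases hnk : n ≤ m ∧ k ≤ m
    · exact boxTruncO_of_le _ hnk.1 hnk.2
    · unfold boxTruncO; rw [if_neg hnk, hY.2.2.2 n k hnk]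

/-- Box families of a fixed level form a finite set when the layer groups are finite. [cite: SerreGaloisCohomology1997, III §4.1 Prop. 8] -/
theorem finite_boxFamiliesO (hfin : ∀ n k : ℕ, Finite (layerCohO S κ₁ κ₂ θ 𝔣 n k 1)) (m : ℕ) : Finite {Y // Y ∈ boxFamiliesO S κ₁ κ₂ θ 𝔣 A m} := by
  haveI := hfin
  refine Finite.of_injective (fun Y : {Y // Y ∈ boxFamiliesO S κ₁ κ₂ θ 𝔣 A m} ↦ fun (i : Fin (m + 1)) (j : Fin (m + 1)) ↦ Y.1 i j) fun Y Y' hYY' ↦ ?_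
  refine Subtype.ext (funext fun n ↦ funext fun k ↦ ?_)
  by_cases hnk : n ≤ m ∧ k ≤ m
  · exact congrFun (congrFun hYY' ⟨n, Nat.lt_succ_of_le hnk.1⟩) ⟨k, Nat.lt_succ_of_le hnk.2⟩
  · rw [Y.2.2.2.2 n k hnk, Y'.2.2.2.2 n k hnk]

omit [NumberField K] in
/-- Transition-closed sets are stable under the iterated maps. [cite: NeukirchSchmidtWingberg2008, I §5 (1.5.1)] -/
theorem mem_of_layerRedLEO (hA₂ : ∀ n k y, y ∈ A n (k + 1) → layerRedO S κ₁ κ₂ θ 𝔣 n k 1 y ∈ A n k) (n k : ℕ) :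
    ∀ (K' : ℕ) (h : k ≤ K') (y : layerCohO S κ₁ κ₂ θ 𝔣 n K' 1), y ∈ A n K' → layerRedLEO S κ₁ κ₂ θ 𝔣 n 1 h y ∈ A n k := by
  refine Nat.le_induction (fun y hy ↦ by rwa [layerRedLEO_refl]) (fun K' hK' ih y hy ↦ ?_)
  rw [layerRedLEO_succ S κ₁ κ₂ θ 𝔣 n 1 hK']
  exact ih _ (hA₂ n K' y hy)

/-- Transition-closed sets are stable under the iterated corestrictions. [cite: NeukirchSchmidtWingberg2008, I §5 (1.5.1)] -/
theorem mem_of_layerCoresLEO (hA₁ : ∀ n k y, y ∈ A (n + 1) k → layerCoresO S κ₁ κ₂ θ 𝔣 n k 1 y ∈ A n k) (n k : ℕ) :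
    ∀ (M : ℕ) (h : n ≤ M) (y : layerCohO S κ₁ κ₂ θ 𝔣 M k 1), y ∈ A M k → layerCoresLEO S κ₁ κ₂ θ 𝔣 k 1 h y ∈ A n k := by
  refine Nat.le_induction (fun y hy ↦ by rwa [layerCoresLEO_refl]) (fun M hM ih y hy ↦ ?_)
  rw [layerCoresLEO_succ S κ₁ κ₂ θ 𝔣 k 1 hM]
  exact ih _ (hA₁ M k y hy)

/-- A diagonal element `e ∈ A m m` spreads to a box family of level `m`. [cite: NeukirchSchmidtWingberg2008, I §5 (1.5.1)] -/
theorem exists_mem_boxFamiliesO (hA₁ : ∀ n k y, y ∈ A (n + 1) k → layerCoresO S κ₁ κ₂ θ 𝔣 n k 1 y ∈ A n k)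
    (hA₂ : ∀ n k y, y ∈ A n (k + 1) → layerRedO S κ₁ κ₂ θ 𝔣 n k 1 y ∈ A n k) (m : ℕ) {e : layerCohO S κ₁ κ₂ θ 𝔣 m m 1} (he : e ∈ A m m) :
    ∃ Y, Y ∈ boxFamiliesO S κ₁ κ₂ θ 𝔣 A m := by
  refine ⟨fun n k ↦ if h : n ≤ m ∧ k ≤ m then layerCoresLEO S κ₁ κ₂ θ 𝔣 k 1 h.1 (layerRedLEO S κ₁ κ₂ θ 𝔣 m 1 h.2 e) else 0,
    fun n k hn hk ↦ ?_, fun n k hn hk ↦ ?_, fun n k hn hk ↦ ?_, fun n k hnk ↦ dif_neg hnk⟩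
  · dsimp only; rw [dif_pos ⟨hn, hk⟩]
    exact mem_of_layerCoresLEO hA₁ n k m hn _ (mem_of_layerRedLEO hA₂ m k m hk e he)
  · dsimp only; rw [dif_pos ⟨hn, hk⟩, dif_pos ⟨Nat.le_of_succ_le hn, hk⟩, layerCoresO_layerCoresLEO]
  · dsimp only; rw [dif_pos ⟨hn, hk⟩, dif_pos ⟨hn, Nat.le_of_succ_le hk⟩, layerRedO_layerCoresLEO, layerRedO_layerRedLEO]

/-- ★ **KŐNIG on the pair layers**: transition-closed level sets `A n k ⊆ H¹(G_S(K̃_n), X_k)` with finite layers and non-empty diagonal are met by the projections of ONE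
element of `D₁.H` ((P4)). [cite: Rubin2000, Prop. B.1.1] [cite: NeukirchSchmidtWingberg2008, I §5 (1.5.1)] -/
theorem exists_proj_mem_of_closed (hfin : ∀ n k : ℕ, Finite (layerCohO S κ₁ κ₂ θ 𝔣 n k 1))
    (hA₁ : ∀ n k y, y ∈ A (n + 1) k → layerCoresO S κ₁ κ₂ θ 𝔣 n k 1 y ∈ A n k)
    (hA₂ : ∀ n k y, y ∈ A n (k + 1) → layerRedO S κ₁ κ₂ θ 𝔣 n k 1 y ∈ A n k) (hne : ∀ m : ℕ, (A m m).Nonempty) :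
    ∃ z : D₁.H, ∀ n k : ℕ, D₁.proj n k z ∈ A n k := by
  haveI : ∀ m : ℕ, Finite {Y // Y ∈ boxFamiliesO S κ₁ κ₂ θ 𝔣 A m} := finite_boxFamiliesO hfin
  haveI : ∀ m : ℕ, Nonempty {Y // Y ∈ boxFamiliesO S κ₁ κ₂ θ 𝔣 A m} := fun m ↦ by
    obtain ⟨e, he⟩ := hne m
    obtain ⟨Y, hY⟩ := exists_mem_boxFamiliesO hA₁ hA₂ m he
    exact ⟨⟨Y, hY⟩⟩
  obtain ⟨s, hs⟩ := exists_seq_forall_proj_of_forall_finite (α := fun m ↦ {Y // Y ∈ boxFamiliesO S κ₁ κ₂ θ 𝔣 A m})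
    (fun {i j} hij Y ↦ ⟨boxTruncO S κ₁ κ₂ θ 𝔣 i Y.1, boxTruncO_mem_boxFamiliesO hij Y.2⟩) (fun i Y ↦ Subtype.ext (boxTruncO_eq_self Y.2))
    (fun i j k hij hjk Y ↦ Subtype.ext (boxTruncO_boxTruncO hij Y.1)) (fun i Y ↦ Set.toFinite _)
  have hval : ∀ {m m' : ℕ} (h : m ≤ m') (n k : ℕ), n ≤ m → k ≤ m → (s m).1 n k = (s m').1 n k := fun {m m'} h n k hn hk ↦ by
    have h1 := congrArg Subtype.val (hs h)
    change boxTruncO S κ₁ κ₂ θ 𝔣 m (s m').1 = (s m).1 at h1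
    rw [← h1, boxTruncO_of_le _ hn hk]
  let y : ∀ n k : ℕ, layerCohO S κ₁ κ₂ θ 𝔣 n k 1 := fun n k ↦ (s (max n k)).1 n k
  have hcores : ∀ n k, layerCoresO S κ₁ κ₂ θ 𝔣 n k 1 (y (n + 1) k) = y n k := fun n k ↦ by
    change layerCoresO S κ₁ κ₂ θ 𝔣 n k 1 ((s (max (n + 1) k)).1 (n + 1) k) = (s (max n k)).1 n k
    rw [hval (max_le_max (Nat.le_succ n) le_rfl) n k (le_max_left n k) (le_max_right n k),
      (s (max (n + 1) k)).2.2.1 n k (le_max_left _ _) (le_max_right _ _)]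
  have hred : ∀ n k, layerRedO S κ₁ κ₂ θ 𝔣 n k 1 (y n (k + 1)) = y n k := fun n k ↦ by
    change layerRedO S κ₁ κ₂ θ 𝔣 n k 1 ((s (max n (k + 1))).1 n (k + 1)) = (s (max n k)).1 n k
    rw [hval (max_le_max le_rfl (Nat.le_succ k)) n k (le_max_left n k) (le_max_right n k),
      (s (max n (k + 1))).2.2.2.1 n k (le_max_left _ _) (le_max_right _ _)]
  obtain ⟨z, hz⟩ := D₁.proj_surjective y ⟨hcores, hred⟩
  exact ⟨z, fun n k ↦ by rw [hz]; exact (s (max n k)).2.1 n k (le_max_left n k) (le_max_right n k)⟩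

end Konig

/-! ## §3 Exactness -/

section Exact

variable [FiniteDimensional ℚ_[p] (padicCoeffField S)] {γ₁ γ₂ : absoluteGaloisGroup K}
  (hγ₁ : γ₂ ∈ κ₁.kerSubgroup) (hγu : IsUnit (κ₂ γ₂).toAdd) (hV : ∀ m : ℕ, ramificationSubgroup K (suppPF p 𝔣) ≤ JohnsonLeungKings2011.pairLayerSubgroup κ₁ κ₂ m)
  (D₁ : IwasawaCohomologyDataO S κ₁ κ₂ γ₁ γ₂ θ 𝔣 1) (D₂ : IwasawaCohomologyDataO S κ₁ κ₂ γ₁ γ₂ θ 𝔣 2) (I : CycIwasawaCohomologyDataO S κ₁ γ₁ θ (suppPF p 𝔣) 1)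
  (res : D₁.H →+ I.H) (hres : ∀ n k y, I.proj n k (res y) = spLevel S κ₁ κ₂ θ 𝔣 n k 1 (D₁.proj n k y))

include hres in
/-- ★ **`δ ∘ sp = 0`** ((L1) levelwise). [cite: SerreGaloisCohomology1997, I §2.2] [cite: PerrinRiou1994Invent, §1.3] -/
theorem deltaHom_res (y : D₁.H) : deltaHom S κ₁ κ₂ θ 𝔣 hγ₁ hγu hV D₂ I (res y) = 0 :=
  D₂.proj_injective _ fun n k ↦ by rw [proj_deltaHom, hres, dLevel_spLevel]

omit [FiniteDimensional ℚ_[p] (padicCoeffField S)] in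
/-- `proj_{n,k} = cor_{K^{(1)}_m/K^{(1)}_n} ∘ proj_{m,k}` on `I` (degree `1`; (P1) iterated through `relCoresO_relCoresO_one`). [cite: NeukirchSchmidtWingberg2008, I §5 Prop. 1.5.3] -/
theorem relCoresO_cyc_proj (x : I.H) (k n : ℕ) : ∀ (m : ℕ) (h : n ≤ m),
    relCoresO S (suppPF p 𝔣) θ (layerSubgroup_le κ₁ h) (κ₁.isOpen_layerSubgroup n) (κ₁.isOpen_layerSubgroup m) k 1 (I.proj m k x) = I.proj n k x := by
  have hstep : ∀ (m : ℕ) (h : n ≤ m), relCoresO S (suppPF p 𝔣) θ (layerSubgroup_le κ₁ h) (κ₁.isOpen_layerSubgroup n) (κ₁.isOpen_layerSubgroup m) k 1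
      (I.proj m k x) = relCoresO S (suppPF p 𝔣) θ (layerSubgroup_le κ₁ (h.trans (Nat.le_succ m))) (κ₁.isOpen_layerSubgroup n)
        (κ₁.isOpen_layerSubgroup (m + 1)) k 1 (I.proj (m + 1) k x) := fun m h ↦ by
    rw [← I.proj_cores m k x, cycLayerCoresO, relCoresO_relCoresO_one]
  refine Nat.le_induction ?_ (fun m hm ih ↦ ?_)
  · rw [hstep n le_rfl, ← I.proj_cores n k x, cycLayerCoresO]
  · rw [← ih, hstep m hm]

include hres in
/-- ★★★ **`δ x = 0 ⇒ x = sp y`** ((L8) at every level `(n, k)` with `m = n + k`; the preimage sets are finite, non-empty and transition-closed; Kőnig; (P4) of `D₁`; (P3) of `I`).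
[cite: PerrinRiou1994Invent, §1.3] [cite: JohnsonLeungKings2011, §4.2 Lemma 4.4] [cite: Rubin2000, Prop. B.1.1] -/
theorem exists_res_eq_of_deltaHom_eq_zero (hP : (suppPF p 𝔣).Finite) (x : I.H) (hx : deltaHom S κ₁ κ₂ θ 𝔣 hγ₁ hγu hV D₂ I x = 0) :
    ∃ y : D₁.H, res y = x := by
  let A : ∀ n k : ℕ, Set (layerCohO S κ₁ κ₂ θ 𝔣 n k 1) := fun n k ↦ {y | spLevel S κ₁ κ₂ θ 𝔣 n k 1 y = I.proj n k x}
  have hfin : ∀ n k : ℕ, Finite (layerCohO S κ₁ κ₂ θ 𝔣 n k 1) := fun n k ↦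
    SmallImageRttD2Seq.finite_levelCohO_one S θ (suppPF p 𝔣) hP (isOpen_pairLayerSubgroup κ₁ κ₂ n) k
  have hA₁ : ∀ n k y, y ∈ A (n + 1) k → layerCoresO S κ₁ κ₂ θ 𝔣 n k 1 y ∈ A n k := fun n k y hy ↦ by
    change spLevel S κ₁ κ₂ θ 𝔣 n k 1 (layerCoresO S κ₁ κ₂ θ 𝔣 n k 1 y) = I.proj n k x
    rw [spLevel_layerCoresO_one, hy, I.proj_cores]
  have hA₂ : ∀ n k y, y ∈ A n (k + 1) → layerRedO S κ₁ κ₂ θ 𝔣 n k 1 y ∈ A n k := fun n k y hy ↦ by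
    change spLevel S κ₁ κ₂ θ 𝔣 n k 1 (layerRedO S κ₁ κ₂ θ 𝔣 n k 1 y) = I.proj n k x
    rw [spLevel_layerRedO, hy, I.proj_red]
  have hne : ∀ m : ℕ, (A m m).Nonempty := fun m ↦ by
    have h0 : dLevel S κ₁ κ₂ θ 𝔣 hγ₁ hγu hV m le_rfl (I.proj (m + m) m x) = 0 := by
      rw [← proj_deltaHom S κ₁ κ₂ θ 𝔣 hγ₁ hγu hV D₂ I x m m, hx, map_zero]
    obtain ⟨y, hy⟩ := exists_spLevel_eq_of_dLevel_eq_zero S κ₁ κ₂ θ 𝔣 hγ₁ hγu hV m le_rfl _ h0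
    exact ⟨y, hy.trans (relCoresO_cyc_proj S κ₁ θ 𝔣 I x m m (m + m) (Nat.le_add_right m m))⟩
  obtain ⟨z, hz⟩ := exists_proj_mem_of_closed D₁ hfin hA₁ hA₂ hne
  refine ⟨z, sub_eq_zero.mp (I.proj_injective _ fun n k ↦ ?_)⟩
  rw [map_sub, hres, sub_eq_zero]
  exact hz n k

include hres in
/-- ★★★ **EXACTNESS `ker δ = range sp`** on the pinned data. [cite: PerrinRiou1994Invent, §1.3] [cite: JohnsonLeungKings2011, §4.2 Lemma 4.4] -/
theorem deltaHom_eq_zero_iff (hP : (suppPF p 𝔣).Finite) (x : I.H) :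
    deltaHom S κ₁ κ₂ θ 𝔣 hγ₁ hγu hV D₂ I x = 0 ↔ x ∈ res.range := by
  constructor
  · intro hx
    obtain ⟨y, hy⟩ := exists_res_eq_of_deltaHom_eq_zero S κ₁ κ₂ θ 𝔣 hγ₁ hγu hV D₁ D₂ I res hres hP x hx
    exact ⟨y, hy⟩
  · rintro ⟨y, rfl⟩
    exact deltaHom_res S κ₁ κ₂ θ 𝔣 hγ₁ hγu hV D₁ D₂ I res hres y

include hres in
/-- ★ **`hex₁` of the J2 socket**: for ANY `s : Q → I.H` and onto `π : D₁.H → Q` with `s ∘ π = res` (honda's `s : 𝐇¹₂ ⧸ T₂ 𝐇¹₂ →ₗ 𝐇¹_cyc`, `s ∘ mk = res`,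
`exists_specialisationLinearMap_frame_zero`): `δ₁ x = 0 ↔ x ∈ range s`. [cite: PerrinRiou1994Invent, §1.3] [cite: JohnsonLeungKings2011, §4.2 Lemma 4.4] -/
theorem deltaTors_eq_zero_iff_mem_range (hP : (suppPF p 𝔣).Finite) {Q : Type*} (π : D₁.H → Q) (hπ : Function.Surjective π) (s : Q → I.H)
    (hs : ∀ y, s (π y) = res y) (x : I.H) :
    deltaTors S κ₁ κ₂ θ 𝔣 hγ₁ hγu hV D₂ I x = 0 ↔ x ∈ Set.range s := by
  rw [deltaTors_eq_zero_iff, deltaHom_eq_zero_iff S κ₁ κ₂ θ 𝔣 hγ₁ hγu hV D₁ D₂ I res hres hP]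
  constructor
  · rintro ⟨y, rfl⟩
    exact ⟨π y, hs y⟩
  · rintro ⟨q, rfl⟩
    obtain ⟨y, rfl⟩ := hπ q
    exact ⟨y, (hs y).symm⟩

end Exact

end Summit.BirchSwinnertonDyer.BirchSwinnertonDyer.Theorems.SmallImageRttD2J2Delta

end
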